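import Summits.BirchSwinnertonDyer.BirchSwinnertonDyer.Theorems.SylvesterTwoHeegnerIndexCMDataPairDerivative
import Summits.BirchSwinnertonDyer.BirchSwinnertonDyer.Theorems.SylvesterTwoHeegnerIndexCMDataRecipe
import HarnessLib

/-!
# DATA LAYER (R-f) of leaf (L1), crux `UpperOffV0HSYPlus` (stmt-BirchSwinnertonDyer-19804): the recipe R0
# CALLED END-TO-END at the TWO-PRIME level `9p(ℓℓ')` — the recipe-shape witnesses of #24's SECOND
# per-`(ℓ, ℓ')` block (the classes `c_B(ℓℓ')`) EXIST

Skeleton of record VARIANT M (`Cruxes/UpperOffV0HSYPlus/Lines/coupled_variantM.lean` 406ca288e244d392);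
line card v24, residual (R).  Twin of #R-d (`…CMDataRecipe`, level `9pℓ`) at the level `9p(ℓℓ')` of the
classes `c_B(ℓℓ')`: the point fed to R0 is `P = κ⁻¹ ι_emb(D_ℓ D_ℓ' y_{ℓℓ'})`, its invariance under
`N' = Gal(K̄/K[9p])` modulo `2` is #R-e2's `hfin` through k-ty1's bridge, the rest of the package is #R-c
instantiated at the field index `ℓℓ'`.

* `exists_fixedPoints_zsmul_eq_smul_map_derivOp_derivOp_sub` — R0's `hP` at the two-prime level;
* `exists_recipeShape_sylvester_pair` — the end-to-end call (any twist parameter `c` with a cube root in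
  `K[9p]`, any model `W` of `E_9` with `Dt`, equivariant `κ`, `2 ∣ a_ℓ, a_ℓ'`);
* `exists_recipeShape_cubicTwist_pair_sylvesterNineMinimal` — both twists `E_p`, `E_{3p²}`, with `κ` and
  `2 ∣ a_q` DISCHARGED for `W₀ = ⟨0,0,1,0,−1⟩`: given ONLY `Dt : ModularParametrizationData W₀ 243`, the route
  binders and the primes, the recipe-shape witnesses of #24's second block exist.

HONEST FRAMING: theorems only (no definition, no named fact, no instance, no notation); assembly of PROVED
tree theorems; the AT-LEVEL FLIP iffs, the height display and BSD are NOT touched; no stub of VARIANT M is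
closed; `--supports stmt-BirchSwinnertonDyer-19804 --as helper`.

## References
* B. H. Gross, LMS LNS 153 (1991), §3–§4. [GrossLMS1991] · W. G. McCallum, same volume, §4. [McCallumLMS1991]
* Y. Hu, J. Shu, H. Yin, Trans. AMS 372 (2019), arXiv 1708.05266 §2, §4.1. [HuShuYin2019]

## Mathlib / tree search
Tree: R0 `HuShuYin2019.exists_cmFrame_kolyvaginClass`; #R-a … #R-e2 of this series;
`RingClassGalOverCyclic.exists_zpowers_eq_ringClassGalOver_mul`; `GeomPointsEmbeddingDescent`;
`exists_frameTransport_cubeSumCurve_nine`, `j_sylvesterNineMinimal`, `not_dvd_minimalDiscriminantInt_sylvesterNineMinimal`.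
`lean search 'recipeShape.*pair'` → nothing before this file. presearch: n/a (assembly).
-/

set_option linter.dupNamespace false -- Summits modules are `Summit.<Summit>.<Problem>…` by design

noncomputable section

open scoped Classical

namespace Summit.BirchSwinnertonDyer.BirchSwinnertonDyer.Theorems.SylvesterTwoCMData

open Complex UpperHalfPlane NumberField WeierstrassCurve
open Literature.NumberTheory.EllipticCurves Literature.NumberTheory.EllipticCurves.ModularForms
  Literature.NumberTheory.EllipticCurves.HuShuYin2019
  Summit.BirchSwinnertonDyer.Rank1Residual.X11b.RingClassTower

variable {K : Type} [Field K] [NumberField K]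

/-- **R0's `hP` at the two-prime level `9p(ℓℓ')`**: for `N = Gal(K̄/emb K[9p(ℓℓ')])` and any `N'` fixing
`emb x` for the `x` lying in `K[9p]`, every `h ∈ N'` satisfies `∃ a ∈ E(K̄)^N, 2^M • a = h • P − P` for
`P = ι_emb(D_ℓ D_ℓ' y_{ℓℓ'})` (#R-e2's `hfin` through `exists_fixedPoints_zsmul_eq_of_finite_level`; the bridge
binder carries the classical `DecidableEq`, the genuine-instance `hfin` is moved across by `convert`).
[cite: GrossLMS1991, §3 Prop. 3.6, §4 (4.1)–(4.4)] [cite: McCallumLMS1991, §4 (4)] -/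
theorem exists_fixedPoints_zsmul_eq_smul_map_derivOp_derivOp_sub (hK : IsImaginaryQuadratic K)
    (hdK : NumberField.discr K = -3) (ι : K →+* ℂ) {W : WeierstrassCurve ℚ}
    (Dt : ModularParametrizationData W 243) {p ℓ ℓ' : ℕ} (hp : p % 3 = 1) (hℓ : ℓ.Prime)
    (hℓ3 : ℓ % 3 = 2) (hℓ' : ℓ'.Prime) (hℓ'3 : ℓ' % 3 = 2) (hne : ℓ ≠ ℓ') (hℓp : ¬ ℓ ∣ p)
    (hℓ'p : ¬ ℓ' ∣ p) (hinert : (Ideal.span {(ℓ : 𝓞 K)}).IsPrime)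
    (hinert' : (Ideal.span {(ℓ' : 𝓞 K)}).IsPrime) {M : ℕ} (hMℓ : 2 ^ M ∣ ℓ + 1) (hMℓ' : 2 ^ M ∣ ℓ' + 1)
    (hMa : ((2 ^ M : ℕ) : ℤ) ∣ W.LFunction ℓ) (hMa' : ((2 ^ M : ℕ) : ℤ) ∣ W.LFunction ℓ')
    {σ σ' : ringClassField K ι (9 * p * (ℓ * ℓ')) ≃ₐ[ℚ] ringClassField K ι (9 * p * (ℓ * ℓ'))}
    (hσ : Subgroup.zpowers σ = ringClassGalOver ι (9 * p * (ℓ * ℓ')) (9 * p * ℓ'))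
    (hσ' : Subgroup.zpowers σ' = ringClassGalOver ι (9 * p * (ℓ * ℓ')) (9 * p * ℓ))
    {y yℓ yℓ' : (W.baseChange (ringClassField K ι (9 * p * (ℓ * ℓ')))).toAffine.Point}
    (hy : Affine.Point.map (W' := W) (ringClassField K ι (9 * p * (ℓ * ℓ'))).subtype.toRatAlgHom y =
      Dt.φ (heegnerTau (((ℓ * ℓ' : ℕ) : ℤ) ^ 2 * (81 * ((p : ℤ) ^ 2 + 4 * p + 16)),
        ((ℓ * ℓ' : ℕ) : ℤ) * (-(9 * (4 * (p : ℤ) ^ 2 + 17 * p + 72))), 4 * (p : ℤ) ^ 2 + 18 * p + 81)))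
    (hyℓ : Affine.Point.map (W' := W) (ringClassField K ι (9 * p * (ℓ * ℓ'))).subtype.toRatAlgHom yℓ =
      Dt.φ (heegnerTau ((ℓ : ℤ) ^ 2 * (81 * ((p : ℤ) ^ 2 + 4 * p + 16)),
        (ℓ : ℤ) * (-(9 * (4 * (p : ℤ) ^ 2 + 17 * p + 72))), 4 * (p : ℤ) ^ 2 + 18 * p + 81)))
    (hyℓ' : Affine.Point.map (W' := W) (ringClassField K ι (9 * p * (ℓ * ℓ'))).subtype.toRatAlgHom yℓ' =
      Dt.φ (heegnerTau ((ℓ' : ℤ) ^ 2 * (81 * ((p : ℤ) ^ 2 + 4 * p + 16)),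
        (ℓ' : ℤ) * (-(9 * (4 * (p : ℤ) ^ 2 + 17 * p + 72))), 4 * (p : ℤ) ^ 2 + 18 * p + 81)))
    (emb : ringClassField K ι (9 * p * (ℓ * ℓ')) →+* AlgebraicClosure K)
    (hemb : ∀ k : K, emb (algebraMap K (ringClassField K ι (9 * p * (ℓ * ℓ'))) k) =
      algebraMap K (AlgebraicClosure K) k)
    (ιe : letI : DecidableEq (ringClassField K ι (9 * p * (ℓ * ℓ'))) := fun a b ↦ Classical.propDecidable (a = b)
      (W.baseChange (ringClassField K ι (9 * p * (ℓ * ℓ')))).toAffine.Point →+ geomPoints (W.baseChange K))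
    (hιe : ∀ P, ιe P = Affine.Point.map (W' := W) emb.toRatAlgHom P)
    (N : Subgroup (Field.absoluteGaloisGroup K))
    (hN : ∀ g : Field.absoluteGaloisGroup K, g ∈ N ↔
      ∀ x : ringClassField K ι (9 * p * (ℓ * ℓ')),
        (show AlgebraicClosure K ≃ₐ[K] AlgebraicClosure K from g) (emb x) = emb x)
    (N' : Subgroup (Field.absoluteGaloisGroup K))
    (hN' : ∀ g : Field.absoluteGaloisGroup K, g ∈ N' ↔
      ∀ x ∈ {x : ringClassField K ι (9 * p * (ℓ * ℓ')) | (x : ℂ) ∈ ringClassField K ι (9 * p)},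
        (show AlgebraicClosure K ≃ₐ[K] AlgebraicClosure K from g) (emb x) = emb x) :
    ∀ h ∈ N', ∃ a ∈ FixedPoints.addSubgroup N (geomPoints (W.baseChange K)),
      ((2 ^ M : ℕ) : ℤ) • a =
        h • ιe (KolyvaginOperator.derivOp (pointGalHom W (ringClassField K ι (9 * p * (ℓ * ℓ')))) σ ℓ
              (KolyvaginOperator.derivOp (pointGalHom W (ringClassField K ι (9 * p * (ℓ * ℓ')))) σ' ℓ' y)) -
          ιe (KolyvaginOperator.derivOp (pointGalHom W (ringClassField K ι (9 * p * (ℓ * ℓ')))) σ ℓ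
              (KolyvaginOperator.derivOp (pointGalHom W (ringClassField K ι (9 * p * (ℓ * ℓ')))) σ' ℓ' y)) := by
  intro h hh
  have hp0 : p ≠ 0 := by rintro rfl; simp at hp
  have hn0 : 9 * p * (ℓ * ℓ') ≠ 0 :=
    mul_ne_zero (mul_ne_zero (by norm_num) hp0) (mul_ne_zero hℓ.ne_zero hℓ'.ne_zero)
  haveI := (finiteDimensional_and_isGalois_ringClassField hK ι hn0).2
  have key := exists_zsmul_eq_map_derivOp_derivOp_sub_of_fix hK hdK ι Dt hp hℓ hℓ3 hℓ' hℓ'3 hne hℓp hℓ'p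
    hinert hinert' hMℓ hMℓ' hMa hMa' hσ hσ' hy hyℓ hyℓ'
  refine exists_fixedPoints_zsmul_eq_of_finite_level W emb hemb ιe hιe N hN _ _
    {x : ringClassField K ι (9 * p * (ℓ * ℓ')) | (x : ℂ) ∈ ringClassField K ι (9 * p)} ?_ h ((hN' h).mp hh)
  intro τ hτ
  obtain ⟨a₀, ha₀⟩ := key τ hτ
  exact ⟨a₀, by convert ha₀⟩

/-- **A generator `σ_ℓ` of `G_ℓ = Gal(K[9p(ℓℓ')]/K[9pℓ'])`** at the two-prime level (x11b3 / Literature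
`RingClassGalOverCyclic.exists_zpowers_eq_ringClassGalOver_mul` with `m' = 9pℓ'`, level rewritten `ℓ·(9pℓ') = 9p(ℓℓ')`).
[cite: GrossLMS1991, §3 (PDF p. 217 l. 1–3)] -/
theorem exists_zpowers_eq_ringClassGalOver_pair_left (hK : IsImaginaryQuadratic K) (ι : K →+* ℂ) {p ℓ ℓ' : ℕ}
    (hp0 : p ≠ 0) (hℓ : ℓ.Prime) (hℓ' : ℓ'.Prime) (hne : ℓ ≠ ℓ') (hℓ9p : ¬ ℓ ∣ 9 * p)
    (hinert : (Ideal.span {(ℓ : 𝓞 K)}).IsPrime) :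
    ∃ σ : ringClassField K ι (9 * p * (ℓ * ℓ')) ≃ₐ[ℚ] ringClassField K ι (9 * p * (ℓ * ℓ')),
      Subgroup.zpowers σ = ringClassGalOver ι (9 * p * (ℓ * ℓ')) (9 * p * ℓ') := by
  have hℓf : ¬ ℓ ∣ 9 * p * ℓ' := fun h ↦ by
    rcases (Nat.Prime.dvd_mul hℓ).mp h with h1 | h2
    · exact hℓ9p h1
    · exact hne ((Nat.prime_dvd_prime_iff_eq hℓ hℓ').mp h2)
  have h := RingClassGalOverCyclic.exists_zpowers_eq_ringClassGalOver_mul hK ι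
    (mul_ne_zero (mul_ne_zero (by norm_num) hp0) hℓ'.ne_zero) hℓ hℓf hinert
  have hlev : ℓ * (9 * p * ℓ') = 9 * p * (ℓ * ℓ') := by ring
  rw [hlev] at h
  exact h

/-- **A generator `σ_ℓ'` of `G_ℓ' = Gal(K[9p(ℓℓ')]/K[9pℓ])`** (level rewritten `ℓ'·(9pℓ) = 9p(ℓℓ')`).
[cite: GrossLMS1991, §3 (PDF p. 217 l. 1–3)] -/
theorem exists_zpowers_eq_ringClassGalOver_pair_right (hK : IsImaginaryQuadratic K) (ι : K →+* ℂ) {p ℓ ℓ' : ℕ}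
    (hp0 : p ≠ 0) (hℓ : ℓ.Prime) (hℓ' : ℓ'.Prime) (hne : ℓ ≠ ℓ') (hℓ'9p : ¬ ℓ' ∣ 9 * p)
    (hinert' : (Ideal.span {(ℓ' : 𝓞 K)}).IsPrime) :
    ∃ σ' : ringClassField K ι (9 * p * (ℓ * ℓ')) ≃ₐ[ℚ] ringClassField K ι (9 * p * (ℓ * ℓ')),
      Subgroup.zpowers σ' = ringClassGalOver ι (9 * p * (ℓ * ℓ')) (9 * p * ℓ) := by
  have hℓ'f : ¬ ℓ' ∣ 9 * p * ℓ := fun h ↦ by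
    rcases (Nat.Prime.dvd_mul hℓ').mp h with h1 | h2
    · exact hℓ'9p h1
    · exact hne ((Nat.prime_dvd_prime_iff_eq hℓ' hℓ).mp h2).symm
  have h := RingClassGalOverCyclic.exists_zpowers_eq_ringClassGalOver_mul hK ι
    (mul_ne_zero (mul_ne_zero (by norm_num) hp0) hℓ.ne_zero) hℓ' hℓ'f hinert'
  have hlev : ℓ' * (9 * p * ℓ) = 9 * p * (ℓ * ℓ') := by ring
  rw [hlev] at h
  exact h

/-- **The CM point of conductor `9pq` as a point of `E(K[9pm])` for `q ∣ m`** (push along `K[9pq] ⊆ K[9pm]`;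
the points `y_ℓ`, `y_ℓ'` of (ES1) at the two-prime level). [cite: GrossLMS1991, §3 (p. 238: y_m ∈ E(K_m) ⊂ E(K_n))] -/
theorem exists_map_eq_phi_sylvesterTau_of_dvd (hK : IsImaginaryQuadratic K) (hdK : NumberField.discr K = -3)
    (ι : K →+* ℂ) {W : WeierstrassCurve ℚ} (Dt : ModularParametrizationData W 243) {p q m : ℕ} (hp : p % 3 = 1)
    (hq : q.Prime) (hq3 : q % 3 = 2) (hqm : q ∣ m) (hm : m ≠ 0) :
    ∃ y : (W.baseChange (ringClassField K ι (9 * p * m))).toAffine.Point,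
      Affine.Point.map (W' := W) (ringClassField K ι (9 * p * m)).subtype.toRatAlgHom y =
        Dt.φ (heegnerTau ((q : ℤ) ^ 2 * (81 * ((p : ℤ) ^ 2 + 4 * p + 16)),
          (q : ℤ) * (-(9 * (4 * (p : ℤ) ^ 2 + 17 * p + 72))), 4 * (p : ℤ) ^ 2 + 18 * p + 81)) := by
  have hp0 : p ≠ 0 := by rintro rfl; simp at hp
  obtain ⟨y₀, hy₀⟩ := exists_map_eq_phi_sylvesterTau_of_primeFactors hK hdK ι Dt (n := q) hp hq.ne_zero
    (fun r hr ↦ by rw [hq.primeFactors, Finset.mem_singleton] at hr; rw [hr]; exact hq3)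
  have hle : ringClassField K ι (9 * p * q) ≤ ringClassField K ι (9 * p * m) :=
    ringClassField_mono hK ι (mul_dvd_mul_left (9 * p) hqm) (mul_ne_zero (mul_ne_zero (by norm_num) hp0) hm)
  refine ⟨Affine.Point.map (W' := W) ((RingClassField.inclusion ι hle).restrictScalars ℚ) y₀, ?_⟩
  rw [← hy₀]
  exact map_toRatAlgHom_map_inclusion (W := W) ι hle (ringClassField K ι (9 * p * m)).subtype
    (ringClassField K ι (9 * p * q)).subtype (fun x' ↦ RingClassField.coe_inclusion ι hle x') y₀

set_option maxHeartbeats 400000 in -- three rationality instances + the R0 call in one assembly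
/-- **THE RECIPE R0 CALLED END-TO-END at the two-prime level `9p(ℓℓ')`** (`M = 1`): for a twist parameter
`c ∈ ℚ`, `c ≠ 0`, with a cube root `z ∈ K[9p]`, and `b = 9c`, the recipe-shape witnesses
`(emb, N, v, ψ, A, hdiv, hA, Q ∈ E₉(K̄)^N, hQ')` of #24's SECOND block exist, `Q = Σᵢ ρ(tᵢ)(tᵢ • P)`,
`P = κ⁻¹ ι_emb(D_ℓ D_ℓ' y_{ℓℓ'})`, with the vanishing criterion of `kolyvaginClass (E_b/K) 2 hdiv hA (ψ Q) hQ'`.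
[cite: GrossLMS1991, §3 Prop. 3.6, §4 (4.1)–(4.4), Prop. 4.7 (1)] [cite: HuShuYin2019, §2 Prop. 2.4, §4.1] -/
theorem exists_recipeShape_sylvester_pair {ω : K} (hω : ω ^ 2 + ω + 1 = 0)
    (h2 : Module.finrank ℚ K = 2) (ι : K →+* ℂ) {W : WeierstrassCurve ℚ}
    (Dt : ModularParametrizationData W 243)
    (κ : geomPoints ((cubeSumCurve 9).baseChange K) ≃+ geomPoints (W.baseChange K))
    (hκ : ∀ (g : Field.absoluteGaloisGroup K) (P : geomPoints ((cubeSumCurve 9).baseChange K)),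
      κ (g • P) = g • κ P)
    {p ℓ ℓ' : ℕ} (hp : p.Prime) (hp3 : p % 3 = 1) (hℓ : ℓ.Prime) (hℓ3 : ℓ % 3 = 2) (hℓ2 : ℓ ≠ 2)
    (hℓ' : ℓ'.Prime) (hℓ'3 : ℓ' % 3 = 2) (hℓ'2 : ℓ' ≠ 2) (hne : ℓ ≠ ℓ')
    (hMa : ((2 ^ 1 : ℕ) : ℤ) ∣ W.LFunction ℓ) (hMa' : ((2 ^ 1 : ℕ) : ℤ) ∣ W.LFunction ℓ')
    {b c : ℚ} (hc : c ≠ 0) (hb : b = 9 * c)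
    {z : ringClassField K ι (9 * p)} (hz : (z : ℂ) ^ 3 = (c : ℂ)) :
    ∃ (emb : ringClassField K ι (9 * p * (ℓ * ℓ')) →+* AlgebraicClosure K)
      (_ : ∀ k : K, emb (algebraMap K (ringClassField K ι (9 * p * (ℓ * ℓ'))) k) =
        algebraMap K (AlgebraicClosure K) k)
      (N : Subgroup (Field.absoluteGaloisGroup K))
      (_ : ∀ g, g ∈ N ↔ ∀ x : ringClassField K ι (9 * p * (ℓ * ℓ')),
        (show AlgebraicClosure K ≃ₐ[K] AlgebraicClosure K from g) (emb x) = emb x)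
      (v : AlgebraicClosure K)
      (ψ : geomPoints ((cubeSumCurve 9).baseChange K) ≃+ geomPoints ((cubeSumCurve b).baseChange K))
      (_ : ∀ {x y : AlgebraicClosure K}
        (h : (((cubeSumCurve 9).baseChange K).baseChange (AlgebraicClosure K)).toAffine.Nonsingular x y),
        ∃ h', ψ (Affine.Point.some x y h) = Affine.Point.some (v ^ 2 * x) (v ^ 3 * y) h')
      (_ : ∀ h ∈ N, (show AlgebraicClosure K ≃ₐ[K] AlgebraicClosure K from h) v = v)
      (A : AddSubgroup (geomPoints ((cubeSumCurve b).baseChange K)))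
      (hdiv : ∀ P : geomPoints ((cubeSumCurve b).baseChange K),
        ∃ R : geomPoints ((cubeSumCurve b).baseChange K), ((2 ^ 1 : ℕ) : ℤ) • R = P)
      (hA : KolyvaginCocycle.IsAdmissible (Field.absoluteGaloisGroup K) A ((2 ^ 1 : ℕ) : ℤ))
      (Q : geomPoints ((cubeSumCurve 9).baseChange K))
      (_ : Q ∈ FixedPoints.addSubgroup N (geomPoints ((cubeSumCurve 9).baseChange K)))
      (hQ' : ψ Q ∈ KolyvaginCocycle.invPoints (Field.absoluteGaloisGroup K) A ((2 ^ 1 : ℕ) : ℤ)),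
      (kolyvaginClass ((cubeSumCurve b).baseChange K) ((2 ^ 1 : ℕ) : ℤ) hdiv hA (ψ Q) hQ' = 0 ↔
        ∃ B ∈ FixedPoints.addSubgroup N (geomPoints ((cubeSumCurve 9).baseChange K)),
          ((2 ^ 1 : ℕ) : ℤ) • B = Q) := by
  have hK := JZero.isImaginaryQuadratic_of_sq_add_self_add_one hω h2
  have hdK := JZero.discr_eq_neg_three_of_sq_add_self_add_one hω h2
  have hinert := JZero.span_natCast_isPrime_of_mod_three_eq_two hω h2 hℓ hℓ3
  have hinert' := JZero.span_natCast_isPrime_of_mod_three_eq_two hω h2 hℓ' hℓ'3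
  have hp0 : p ≠ 0 := hp.ne_zero
  have hdvdp : ∀ {q : ℕ}, q.Prime → q % 3 = 2 → ¬ q ∣ p := fun {q} hq hq3 h ↦ by
    have := (Nat.prime_dvd_prime_iff_eq hq hp).mp h
    omega
  have hℓp := hdvdp hℓ hℓ3
  have hℓ'p := hdvdp hℓ' hℓ'3
  have h9 : ∀ {q : ℕ}, q.Prime → q % 3 = 2 → ¬ q ∣ 9 * p := fun {q} hq hq3 h ↦ by
    have hq3' : q ≠ 3 := by rintro rfl; simp at hq3
    rcases (Nat.Prime.dvd_mul hq).mp h with h9' | hp'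
    · have h'' : q ∣ 3 ^ 2 := by norm_num; exact h9'
      exact hq3' ((Nat.prime_dvd_prime_iff_eq hq Nat.prime_three).mp (hq.dvd_of_dvd_pow h''))
    · exact hdvdp hq hq3 hp'
  have hmℓ : ℓ * ℓ' ≠ 0 := mul_ne_zero hℓ.ne_zero hℓ'.ne_zero
  have hn0 : 9 * p * (ℓ * ℓ') ≠ 0 := mul_ne_zero (mul_ne_zero (by norm_num) hp0) hmℓ
  have hMℓ : 2 ^ 1 ∣ ℓ + 1 := by
    rw [pow_one]; exact (hℓ.eq_two_or_odd'.resolve_left hℓ2).add_one.two_dvd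
  have hMℓ' : 2 ^ 1 ∣ ℓ' + 1 := by
    rw [pow_one]; exact (hℓ'.eq_two_or_odd'.resolve_left hℓ'2).add_one.two_dvd
  have hp_odd : Odd p := hp.eq_two_or_odd'.resolve_left (by rintro rfl; simp at hp3)
  have hm_odd : Odd (ℓ * ℓ') :=
    (hℓ.eq_two_or_odd'.resolve_left hℓ2).mul (hℓ'.eq_two_or_odd'.resolve_left hℓ'2)
  have hprimes : ∀ q ∈ (ℓ * ℓ').primeFactors, q % 3 = 2 := fun q hq ↦ by
    rw [Nat.primeFactors_mul hℓ.ne_zero hℓ'.ne_zero, Finset.mem_union, hℓ.primeFactors, hℓ'.primeFactors,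
      Finset.mem_singleton, Finset.mem_singleton] at hq
    rcases hq with rfl | rfl
    · exact hℓ3
    · exact hℓ'3
  haveI := (finiteDimensional_and_isGalois_ringClassField hK ι hn0).1
  haveI := (finiteDimensional_and_isGalois_ringClassField hK ι hn0).2
  -- the finite-level data (#R-a; generators from `RingClassGalOverCyclic`)
  obtain ⟨y, hy⟩ := exists_map_eq_phi_sylvesterTau_of_primeFactors hK hdK ι Dt (n := ℓ * ℓ') hp3 hmℓ hprimes
  obtain ⟨yℓ, hyℓ⟩ := exists_map_eq_phi_sylvesterTau_of_dvd hK hdK ι Dt hp3 hℓ hℓ3 (dvd_mul_right ℓ ℓ') hmℓ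
  obtain ⟨yℓ', hyℓ'⟩ := exists_map_eq_phi_sylvesterTau_of_dvd hK hdK ι Dt hp3 hℓ' hℓ'3 (dvd_mul_left ℓ' ℓ) hmℓ
  obtain ⟨σ, hσ⟩ := exists_zpowers_eq_ringClassGalOver_pair_left hK ι hp0 hℓ hℓ' hne (h9 hℓ hℓ3) hinert
  obtain ⟨σ', hσ'⟩ := exists_zpowers_eq_ringClassGalOver_pair_right hK ι hp0 hℓ hℓ' hne (h9 hℓ' hℓ'3) hinert'
  -- the `K̄`-level package (#R-c at the field index `ℓℓ'`)
  obtain ⟨emb, hemb⟩ := exists_emb_ringClassField hK ι hn0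
  obtain ⟨N, hN⟩ := exists_subgroup_mem_iff emb hemb
  haveI : N.Normal := normal_of_mem_iff emb hemb N hN
  obtain ⟨N', hN'⟩ := exists_subgroup_mem_iff_forall emb
    {x : ringClassField K ι (9 * p * (ℓ * ℓ')) | (x : ℂ) ∈ ringClassField K ι (9 * p)}
  have hNN' : N ≤ N' := le_of_mem_iff_of_mem_iff_forall emb hN hN'
  have hN'c := forall_apply_eq_of_coe_pow_three_eq_of_fix_nine_mul hω h2 ι hp0 hmℓ emb hemb N' hN' (c := c) hz
  have h6 := pow_three_ne_six_of_fix_sylvester_prime hK hdK ι hp_odd hm_odd emb hemb N hN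
  obtain ⟨n, t, ht⟩ := exists_transversal_quotient hK ι hp0 hmℓ emb hemb N' hN'
  let ιe : letI : DecidableEq (ringClassField K ι (9 * p * (ℓ * ℓ'))) := fun a b ↦ Classical.propDecidable (a = b)
      (W.baseChange (ringClassField K ι (9 * p * (ℓ * ℓ')))).toAffine.Point →+ geomPoints (W.baseChange K) :=
    letI : DecidableEq (ringClassField K ι (9 * p * (ℓ * ℓ'))) := fun a b ↦ Classical.propDecidable (a = b)
    Affine.Point.map (W' := W) emb.toRatAlgHom
  have hιe : ∀ P, ιe P = Affine.Point.map (W' := W) emb.toRatAlgHom P := fun _ ↦ rfl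
  have hPN := map_emb_mem_fixedPoints W ι emb ιe hιe N hN
    (KolyvaginOperator.derivOp (pointGalHom W (ringClassField K ι (9 * p * (ℓ * ℓ')))) σ ℓ
      (KolyvaginOperator.derivOp (pointGalHom W (ringClassField K ι (9 * p * (ℓ * ℓ')))) σ' ℓ' y))
  have hP := exists_fixedPoints_zsmul_eq_smul_map_derivOp_derivOp_sub hK hdK ι Dt hp3 hℓ hℓ3 hℓ' hℓ'3 hne hℓp
    hℓ'p hinert hinert' hMℓ hMℓ' hMa hMa' hσ hσ' hy hyℓ hyℓ' emb hemb ιe hιe N hN N' hN'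
  obtain ⟨v, ψ, ρ, hdiv, hA', hQ', hvc, -, hψ, -, -, hχA, hc0⟩ :=
    exists_cmFrame_kolyvaginClass K hω b c hc hb N N' hNN' hN'c h6 t ht 1
      (κ.symm (ιe (KolyvaginOperator.derivOp (pointGalHom W (ringClassField K ι (9 * p * (ℓ * ℓ')))) σ ℓ
        (KolyvaginOperator.derivOp (pointGalHom W (ringClassField K ι (9 * p * (ℓ * ℓ')))) σ' ℓ' y))))
      (mem_fixedPoints_symm_of_equivariant κ hκ N hPN)
      (fun h hh ↦ exists_fixedPoints_zsmul_eq_symm_of_equivariant κ hκ N (hP h hh))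
  exact ⟨emb, hemb, N, hN, v, ψ, hψ, fun h hh ↦ hN'c h (hNN' hh) v hvc, _, hdiv, hA', _, hχA, hQ', hc0⟩

/-- **Both twists `E_p`, `E_{3p²}` at the two-prime level, with `κ` and `2 ∣ a_ℓ, a_ℓ'` DISCHARGED for
`W₀ = (y² + y = x³ − 1)`**: given ONLY `Dt : ModularParametrizationData W₀ 243`, the route binders and the
primes, the recipe-shape witnesses of #24's SECOND per-`(ℓ, ℓ')` block exist.
[cite: GrossLMS1991, §3 (3.3), §4] [cite: HuShuYin2019, §1 p. 4, §2, §4.1] [cite: IrelandRosen1990, Ch. 18 §3] -/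
theorem exists_recipeShape_cubicTwist_pair_sylvesterNineMinimal {ω : K} (hω : ω ^ 2 + ω + 1 = 0)
    (h2 : Module.finrank ℚ K = 2) (ι : K →+* ℂ)
    (Dt : ModularParametrizationData (⟨0, 0, 1, 0, -1⟩ : WeierstrassCurve ℚ) 243)
    {p ℓ ℓ' : ℕ} (hp : p.Prime) (hp3 : p % 3 = 1) (hℓ : ℓ.Prime) (hℓ3 : ℓ % 3 = 2) (hℓ2 : ℓ ≠ 2)
    (hℓ' : ℓ'.Prime) (hℓ'3 : ℓ' % 3 = 2) (hℓ'2 : ℓ' ≠ 2) (hne : ℓ ≠ ℓ')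
    {b : ℚ} (hb : b = p ∨ b = 3 * (p : ℚ) ^ 2) :
    ∃ (κ : geomPoints ((cubeSumCurve 9).baseChange K) ≃+
        geomPoints ((⟨0, 0, 1, 0, -1⟩ : WeierstrassCurve ℚ).baseChange K))
      (_ : ∀ (g : Field.absoluteGaloisGroup K) (P : geomPoints ((cubeSumCurve 9).baseChange K)),
        κ (g • P) = g • κ P)
      (emb : ringClassField K ι (9 * p * (ℓ * ℓ')) →+* AlgebraicClosure K)
      (_ : ∀ k : K, emb (algebraMap K (ringClassField K ι (9 * p * (ℓ * ℓ'))) k) =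
        algebraMap K (AlgebraicClosure K) k)
      (N : Subgroup (Field.absoluteGaloisGroup K))
      (_ : ∀ g, g ∈ N ↔ ∀ x : ringClassField K ι (9 * p * (ℓ * ℓ')),
        (show AlgebraicClosure K ≃ₐ[K] AlgebraicClosure K from g) (emb x) = emb x)
      (v : AlgebraicClosure K)
      (ψ : geomPoints ((cubeSumCurve 9).baseChange K) ≃+ geomPoints ((cubeSumCurve b).baseChange K))
      (_ : ∀ {x y : AlgebraicClosure K}
        (h : (((cubeSumCurve 9).baseChange K).baseChange (AlgebraicClosure K)).toAffine.Nonsingular x y),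
        ∃ h', ψ (Affine.Point.some x y h) = Affine.Point.some (v ^ 2 * x) (v ^ 3 * y) h')
      (_ : ∀ h ∈ N, (show AlgebraicClosure K ≃ₐ[K] AlgebraicClosure K from h) v = v)
      (A : AddSubgroup (geomPoints ((cubeSumCurve b).baseChange K)))
      (hdiv : ∀ P : geomPoints ((cubeSumCurve b).baseChange K),
        ∃ R : geomPoints ((cubeSumCurve b).baseChange K), ((2 ^ 1 : ℕ) : ℤ) • R = P)
      (hA : KolyvaginCocycle.IsAdmissible (Field.absoluteGaloisGroup K) A ((2 ^ 1 : ℕ) : ℤ))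
      (Q : geomPoints ((cubeSumCurve 9).baseChange K))
      (_ : Q ∈ FixedPoints.addSubgroup N (geomPoints ((cubeSumCurve 9).baseChange K)))
      (hQ' : ψ Q ∈ KolyvaginCocycle.invPoints (Field.absoluteGaloisGroup K) A ((2 ^ 1 : ℕ) : ℤ)),
      (kolyvaginClass ((cubeSumCurve b).baseChange K) ((2 ^ 1 : ℕ) : ℤ) hdiv hA (ψ Q) hQ' = 0 ↔
        ∃ B ∈ FixedPoints.addSubgroup N (geomPoints ((cubeSumCurve 9).baseChange K)),
          ((2 ^ 1 : ℕ) : ℤ) • B = Q) := by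
  haveI := isElliptic_sylvesterNineMinimal
  haveI := isGloballyMinimal_sylvesterNineMinimal
  have hMa : ∀ {q : ℕ}, q.Prime → q % 3 = 2 → q ≠ 2 →
      ((2 ^ 1 : ℕ) : ℤ) ∣ (⟨0, 0, 1, 0, -1⟩ : WeierstrassCurve ℚ).LFunction q := fun {q} hq hq3 hq2 ↦ by
    have hq3' : q ≠ 3 := by rintro rfl; simp at hq3
    rw [JZero.lFunction_eq_zero_of_j_eq_zero_of_mod_three_eq_two _ j_sylvesterNineMinimal hq hq3 hq2
      (not_dvd_minimalDiscriminantInt_sylvesterNineMinimal hq hq3')]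
    exact dvd_zero _
  obtain ⟨κ, hκ, -⟩ := exists_frameTransport_cubeSumCurve_nine K
  have hp0 : (p : ℚ) ≠ 0 := by exact_mod_cast hp.ne_zero
  rcases hb with rfl | rfl
  · obtain ⟨z, hz⟩ := exists_coe_pow_three_eq_div_nine hω h2 ι hp.ne_zero
    obtain ⟨emb, hemb, N, hN, v, ψ, hψ, hNv, A, hdiv, hA, Q, hQN, hQ', hc0⟩ :=
      exists_recipeShape_sylvester_pair hω h2 ι Dt κ hκ hp hp3 hℓ hℓ3 hℓ2 hℓ' hℓ'3 hℓ'2 hne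
        (hMa hℓ hℓ3 hℓ2) (hMa hℓ' hℓ'3 hℓ'2) (b := (p : ℚ)) (c := (p : ℚ) / 9) (by positivity) (by ring) hz
    exact ⟨κ, hκ, emb, hemb, N, hN, v, ψ, hψ, hNv, A, hdiv, hA, Q, hQN, hQ', hc0⟩
  · obtain ⟨z, hz⟩ := exists_coe_pow_three_eq_sq_div_three hω h2 ι hp.ne_zero
    obtain ⟨emb, hemb, N, hN, v, ψ, hψ, hNv, A, hdiv, hA, Q, hQN, hQ', hc0⟩ :=
      exists_recipeShape_sylvester_pair hω h2 ι Dt κ hκ hp hp3 hℓ hℓ3 hℓ2 hℓ' hℓ'3 hℓ'2 hne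
        (hMa hℓ hℓ3 hℓ2) (hMa hℓ' hℓ'3 hℓ'2) (b := 3 * (p : ℚ) ^ 2) (c := (p : ℚ) ^ 2 / 3) (by positivity)
        (by ring) hz
    exact ⟨κ, hκ, emb, hemb, N, hN, v, ψ, hψ, hNv, A, hdiv, hA, Q, hQN, hQ', hc0⟩


/-- **#24's SECOND per-`(ℓ, ℓ')` ∃-block (the class `c_B(ℓℓ')` on `E_p` at the level `9p(ℓℓ')` in recipe
shape), VERBATIM minus the FLIP iff** — `(2 : ℕ)` literals, `∃ c ιK emb … hQ', c = kolyvaginClass (E_p/K) 2 hdiv hA (ψ Q) hQ'`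
(planner D453 (3)(i)/(ii)); hypotheses: route binders, any model `W` of `E_9` with `Dt`, equivariant `κ`,
`2 ∣ a_ℓ, a_ℓ'`, primes `p ≡ 1 (3)`, `ℓ ≠ ℓ'` both `≡ 2 (3)` and `≠ 2`. [cite: GrossLMS1991, §4 (4.1)–(4.4)] [cite: HuShuYin2019, §2 p. 8] -/
theorem exists_recipeBlock_pair_prime {ω : K} (hω : ω ^ 2 + ω + 1 = 0)
    (h2 : Module.finrank ℚ K = 2) (ι : K →+* ℂ) {W : WeierstrassCurve ℚ}
    (Dt : ModularParametrizationData W 243)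
    (κ : geomPoints ((cubeSumCurve 9).baseChange K) ≃+ geomPoints (W.baseChange K))
    (hκ : ∀ (g : Field.absoluteGaloisGroup K) (P : geomPoints ((cubeSumCurve 9).baseChange K)),
      κ (g • P) = g • κ P)
    {p ℓ ℓ' : ℕ} (hp : p.Prime) (hp3 : p % 3 = 1) (hℓ : ℓ.Prime) (hℓ3 : ℓ % 3 = 2) (hℓ2 : ℓ ≠ 2)
    (hℓ' : ℓ'.Prime) (hℓ'3 : ℓ' % 3 = 2) (hℓ'2 : ℓ' ≠ 2) (hne : ℓ ≠ ℓ')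
    (hMa : ((2 ^ 1 : ℕ) : ℤ) ∣ W.LFunction ℓ) (hMa' : ((2 ^ 1 : ℕ) : ℤ) ∣ W.LFunction ℓ') :
    ∃ (c : galH1Torsion ((cubeSumCurve (p : ℚ)).baseChange K) (2 : ℕ))
      (ιK : K →+* ℂ) (emb : ringClassField K ιK (9 * p * (ℓ * ℓ')) →+* AlgebraicClosure K)
      (_ : ∀ k : K, emb (algebraMap K (ringClassField K ιK (9 * p * (ℓ * ℓ'))) k) =
        algebraMap K (AlgebraicClosure K) k)
      (N : Subgroup (Field.absoluteGaloisGroup K))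
      (_ : ∀ g, g ∈ N ↔ ∀ x : ringClassField K ιK (9 * p * (ℓ * ℓ')),
        (show AlgebraicClosure K ≃ₐ[K] AlgebraicClosure K from g) (emb x) = emb x)
      (v : AlgebraicClosure K)
      (ψ : geomPoints ((cubeSumCurve 9).baseChange K) ≃+ geomPoints ((cubeSumCurve (p : ℚ)).baseChange K))
      (_ : ∀ {x y : AlgebraicClosure K}
        (h : (((cubeSumCurve 9).baseChange K).baseChange (AlgebraicClosure K)).toAffine.Nonsingular x y),
        ∃ h', ψ (Affine.Point.some x y h) = Affine.Point.some (v ^ 2 * x) (v ^ 3 * y) h')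
      (_ : ∀ h ∈ N, (show AlgebraicClosure K ≃ₐ[K] AlgebraicClosure K from h) v = v)
      (A : AddSubgroup (geomPoints ((cubeSumCurve (p : ℚ)).baseChange K)))
      (hdiv : ∀ P : geomPoints ((cubeSumCurve (p : ℚ)).baseChange K),
        ∃ R : geomPoints ((cubeSumCurve (p : ℚ)).baseChange K), ((2 : ℕ) : ℤ) • R = P)
      (hA : KolyvaginCocycle.IsAdmissible (Field.absoluteGaloisGroup K) A ((2 : ℕ) : ℤ))
      (Q : geomPoints ((cubeSumCurve 9).baseChange K))
      (_ : Q ∈ FixedPoints.addSubgroup N (geomPoints ((cubeSumCurve 9).baseChange K)))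
      (hQ' : ψ Q ∈ KolyvaginCocycle.invPoints (Field.absoluteGaloisGroup K) A ((2 : ℕ) : ℤ)),
      c = kolyvaginClass ((cubeSumCurve (p : ℚ)).baseChange K) ((2 : ℕ) : ℤ) hdiv hA (ψ Q) hQ' := by
  have hp0 : (p : ℚ) ≠ 0 := by exact_mod_cast hp.ne_zero
  obtain ⟨z, hz⟩ := exists_coe_pow_three_eq_div_nine hω h2 ι hp.ne_zero
  obtain ⟨emb, hemb, N, hN, v, ψ, hψ, hNv, A, hdiv, hA, Q, hQN, hQ', -⟩ :=
    exists_recipeShape_sylvester_pair hω h2 ι Dt κ hκ hp hp3 hℓ hℓ3 hℓ2 hℓ' hℓ'3 hℓ'2 hne hMa hMa'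
      (b := (p : ℚ)) (c := (p : ℚ) / 9) (by positivity) (by ring) hz
  exact ⟨_, ι, emb, hemb, N, hN, v, ψ, hψ, hNv, A, hdiv, hA, Q, hQN, hQ', rfl⟩

end Summit.BirchSwinnertonDyer.BirchSwinnertonDyer.Theorems.SylvesterTwoCMData

end
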